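import Summits.KontsevichZagierPeriods.Zeta5Search.LaiSweepShard

/-!
# `κ₃` sweep certificate — shard file 026 of 127 (shards 182–188 of 889)

HONEST FRAMING. Systematic search; no irrationality claim unless certified. This file only checks,
by `decide +kernel`, shards 182–188 of the order-cell sweep of the `κ₃` point `(74, 2180, 444; δ74)`
(engine `LaiSweepEngine`, soundness `LaiSweepJump/Free/Eval/Shard/Kappa3`; a shard is `⟨regime, n,
p, q, p', q', Lo, Up⟩`: `n` cells from `p/q` to `p'/q'` with integer rate sums in `[Lo, Up]`, `K =
128`, `D = 2^40`). It draws NO conclusion: only the capstone `LaiKappa3SweepCert`, which needs all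
127 shard files, does. Kernel cost of this file ≈ 560 cells × 0.3 s.
-/

namespace Summit.KontsevichZagierPeriods.Zeta5Search.Sweep

set_option maxHeartbeats 100000000 in
/-- Shard 182: 80 cells of regime B from `32/289` to `38/339`.
[cite: Lai2024BallRivoal, §4 Lemma 4.3] -/
theorem shard182 :
    Shard.check 128 (2^40)
      ⟨true, 80, 32, 289, 38, 339, 63514280013156, 64013620657022⟩ = true := by
  decide +kernel

set_option maxHeartbeats 100000000 in
/-- Shard 183: 80 cells of regime B from `38/339` to `40/353`.
[cite: Lai2024BallRivoal, §4 Lemma 4.3] -/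
theorem shard183 :
    Shard.check 128 (2^40)
      ⟨true, 80, 38, 339, 40, 353, 56122040574155, 56550833452071⟩ = true := by
  decide +kernel

set_option maxHeartbeats 100000000 in
/-- Shard 184: 80 cells of regime B from `40/353` to `37/323`.
[cite: Lai2024BallRivoal, §4 Lemma 4.3] -/
theorem shard184 :
    Shard.check 128 (2^40)
      ⟨true, 80, 40, 353, 37, 323, 56220171983384, 56661784754162⟩ = true := by
  decide +kernel

set_option maxHeartbeats 100000000 in
/-- Shard 185: 80 cells of regime B from `37/323` to `30/259`.
[cite: Lai2024BallRivoal, §4 Lemma 4.3] -/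
theorem shard185 :
    Shard.check 128 (2^40)
      ⟨true, 80, 37, 323, 30, 259, 57460524491401, 57924114938782⟩ = true := by
  decide +kernel

set_option maxHeartbeats 100000000 in
/-- Shard 186: 80 cells of regime B from `30/259` to `35/299`.
[cite: Lai2024BallRivoal, §4 Lemma 4.3] -/
theorem shard186 :
    Shard.check 128 (2^40)
      ⟨true, 80, 30, 259, 35, 299, 54483537477425, 54932349223426⟩ = true := by
  decide +kernel

set_option maxHeartbeats 100000000 in
/-- Shard 187: 80 cells of regime B from `35/299` to `20/169`.
[cite: Lai2024BallRivoal, §4 Lemma 4.3] -/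
theorem shard187 :
    Shard.check 128 (2^40)
      ⟨true, 80, 35, 299, 20, 169, 56616125974466, 57099817372433⟩ = true := by
  decide +kernel

set_option maxHeartbeats 100000000 in
/-- Shard 188: 80 cells of regime B from `20/169` to `11/92`.
[cite: Lai2024BallRivoal, §4 Lemma 4.3] -/
theorem shard188 :
    Shard.check 128 (2^40)
      ⟨true, 80, 20, 169, 11, 92, 53098678246926, 53556619267501⟩ = true := by
  decide +kernel

/-- The checked shards of this file, in order. [folklore] -/
def shards026 : List (CheckedShard 128 (2^40)) :=
  [⟨_, shard182⟩, ⟨_, shard183⟩, ⟨_, shard184⟩, ⟨_, shard185⟩, ⟨_, shard186⟩,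
    ⟨_, shard187⟩, ⟨_, shard188⟩]

end Summit.KontsevichZagierPeriods.Zeta5Search.Sweep
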